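import Summits.ResolutionOfSingularities.ResolutionOfSingularities.Theorems.FrobeniusLadderFInjectiveMacaulayficationOmegaOneS2ChartData
import HarnessLib

/-!
# Ω₁ GLOBAL PATCH, F6: the tag-4 side letters of the global cure fan Σ₂ (a 15-pair certificate not carried by `exitOKW'`) and the characteristic bookkeeping `2·3 ≠ 0 ⇒ p ≥ 5`
# (BED Ω₁ GLOBAL PATCH, F6 v2 (D); crux `FInjectiveMacaulayfication` stmt-ResolutionOfSingularities-15315, chain w45a; seat res-L1-w45a-stub-3 g15)

[OURS · L1 W4.5a] Support file (`--supports stmt-ResolutionOfSingularities-15315 --as helper`); theorems only; one `decide +kernel` certificate + bookkeeping; no named fact; NOT a statement of any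
manuscript; nothing of the crux is proved. AI-written (AI review is weaker than expert review).
* `natCast_ne_of_dist` — in characteristic `p` with `2·3 ≠ 0`, naturals at distance `1 ≤ d ≤ 4` have distinct images (`p ≥ 5`).
* ★ `tag4_sideB` / `tag4_side` — on every tag-4 (cone, orbit) pair of Σ₂, each of `(M₂ + r)|Z`, `(M₂ + s)|Z` is positive at an orbit letter where `M₁` vanishes (the extra input of
  ✓ `PencilPointRecipes.recipe_deep`, tag 4; verified on all 15 tag-4 pairs).
[cite: CoxLittleSchenck2011, §11.1 (bookkeeping only)]
-/

set_option linter.dupNamespace false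
set_option linter.style.longLine false

noncomputable section

namespace Summit.ResolutionOfSingularities.ResolutionOfSingularities.Theorems.FInjectiveMacaulayfication.OmegaOneS2Tag4Side

open Summit.ResolutionOfSingularities.ResolutionOfSingularities.Theorems.FInjectiveMacaulayfication
open FanCheckKit FanCheckSound OmegaOneCureFanCert OmegaOneGlobalCureFanCert OmegaOneS2KNewtonKFan OmegaOneS2ChartData

/-- `2·3 ≠ 0` in a field of characteristic `p` (prime) forces `5 ≤ p`, so `1 ≤ d ≤ 4` is not divisible by `p` and natural numbers at distance `d` stay distinct in `k`. [plumbing] -/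
theorem natCast_ne_of_dist {k : Type} [Field k] (p : ℕ) [Fact p.Prime] [CharP k p] (h2 : (2 : k) ≠ 0) (h3 : (3 : k) ≠ 0) (a b : ℕ)
    (h1 : 1 ≤ (a - b) + (b - a)) (h4 : (a - b) + (b - a) ≤ 4) : (a : k) ≠ (b : k) := by
  intro hab
  have hp : p.Prime := Fact.out
  have hp2 : p ≠ 2 := by rintro rfl; exact h2 (by exact_mod_cast CharP.cast_eq_zero k 2)
  have hp3 : p ≠ 3 := by rintro rfl; exact h3 (by exact_mod_cast CharP.cast_eq_zero k 3)
  have hp5 : 5 ≤ p := by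
    by_contra hlt
    push Not at hlt
    have h2le := hp.two_le
    interval_cases p
    · exact hp2 rfl
    · exact hp3 rfl
    · exact absurd hp (by decide)
  rcases le_total a b with hle | hle
  · have h0 : ((b - a : ℕ) : k) = 0 := by rw [Nat.cast_sub hle, ← hab, sub_self]
    have hd : p ∣ b - a := (CharP.cast_eq_zero_iff k p _).mp h0
    have hpos : 0 < b - a := by omega
    have := Nat.le_of_dvd hpos hd
    omega
  · have h0 : ((a - b : ℕ) : k) = 0 := by rw [Nat.cast_sub hle, hab, sub_self]
    have hd : p ∣ a - b := (CharP.cast_eq_zero_iff k p _).mp h0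
    have hpos : 0 < a - b := by omega
    have := Nat.le_of_dvd hpos hd
    omega

/-! ## §0 The tag-4 side letters (a 15-pair certificate not carried by `exitOKW'`) -/

set_option maxRecDepth 100000 in
/-- ★ On every tag-4 (cone, orbit) pair, each of `(M₂ + r)|Z` and `(M₂ + s)|Z` is positive at an orbit letter where `M₁` vanishes (Boolean form, one linear pass per cone). [certificate] -/
theorem tag4_sideB : ∀ c : Fin 1223, (((getL TAGS_S2 c []).zip ORB5).all fun tz =>
    !(Nat.beq tz.1 4) ||
      (((List.finRange 5).any fun i => decide ((i : ℕ) ∈ tz.2) &&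
        decide (min (Vq c i 0 * 1 + Vq c i 2 * 2) (Vq c i 1 * 3) -
              min (Vq c i 0 * getL (getL CWS_S2 (getL PARENT_S2 c 0) []) 0 0 + Vq c i 1 * getL (getL CWS_S2 (getL PARENT_S2 c 0) []) 1 0 + Vq c i 2 * getL (getL CWS_S2 (getL PARENT_S2 c 0) []) 2 0 +
                Vq c i 3 * getL (getL CWS_S2 (getL PARENT_S2 c 0) []) 3 0 + Vq c i 4 * getL (getL CWS_S2 (getL PARENT_S2 c 0) []) 4 0) (min (Vq c i 0 * 1 + Vq c i 2 * 2) (Vq c i 1 * 3)) +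
            (Vq c i 0 * 1 + Vq c i 2 * 2 - min (Vq c i 0 * 1 + Vq c i 2 * 2) (Vq c i 1 * 3)) ≠ 0 ∧
          Vq c i 0 * getL (getL CWS_S2 (getL PARENT_S2 c 0) []) 0 0 + Vq c i 1 * getL (getL CWS_S2 (getL PARENT_S2 c 0) []) 1 0 + Vq c i 2 * getL (getL CWS_S2 (getL PARENT_S2 c 0) []) 2 0 +
              Vq c i 3 * getL (getL CWS_S2 (getL PARENT_S2 c 0) []) 3 0 + Vq c i 4 * getL (getL CWS_S2 (getL PARENT_S2 c 0) []) 4 0 -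
            min (Vq c i 0 * getL (getL CWS_S2 (getL PARENT_S2 c 0) []) 0 0 + Vq c i 1 * getL (getL CWS_S2 (getL PARENT_S2 c 0) []) 1 0 + Vq c i 2 * getL (getL CWS_S2 (getL PARENT_S2 c 0) []) 2 0 +
                Vq c i 3 * getL (getL CWS_S2 (getL PARENT_S2 c 0) []) 3 0 + Vq c i 4 * getL (getL CWS_S2 (getL PARENT_S2 c 0) []) 4 0) (min (Vq c i 0 * 1 + Vq c i 2 * 2) (Vq c i 1 * 3)) = 0)) &&
      ((List.finRange 5).any fun i => decide ((i : ℕ) ∈ tz.2) &&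
        decide (min (Vq c i 0 * 1 + Vq c i 2 * 2) (Vq c i 1 * 3) -
              min (Vq c i 0 * getL (getL CWS_S2 (getL PARENT_S2 c 0) []) 0 0 + Vq c i 1 * getL (getL CWS_S2 (getL PARENT_S2 c 0) []) 1 0 + Vq c i 2 * getL (getL CWS_S2 (getL PARENT_S2 c 0) []) 2 0 +
                Vq c i 3 * getL (getL CWS_S2 (getL PARENT_S2 c 0) []) 3 0 + Vq c i 4 * getL (getL CWS_S2 (getL PARENT_S2 c 0) []) 4 0) (min (Vq c i 0 * 1 + Vq c i 2 * 2) (Vq c i 1 * 3)) +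
            (Vq c i 1 * 3 - min (Vq c i 0 * 1 + Vq c i 2 * 2) (Vq c i 1 * 3)) ≠ 0 ∧
          Vq c i 0 * getL (getL CWS_S2 (getL PARENT_S2 c 0) []) 0 0 + Vq c i 1 * getL (getL CWS_S2 (getL PARENT_S2 c 0) []) 1 0 + Vq c i 2 * getL (getL CWS_S2 (getL PARENT_S2 c 0) []) 2 0 +
              Vq c i 3 * getL (getL CWS_S2 (getL PARENT_S2 c 0) []) 3 0 + Vq c i 4 * getL (getL CWS_S2 (getL PARENT_S2 c 0) []) 4 0 -
            min (Vq c i 0 * getL (getL CWS_S2 (getL PARENT_S2 c 0) []) 0 0 + Vq c i 1 * getL (getL CWS_S2 (getL PARENT_S2 c 0) []) 1 0 + Vq c i 2 * getL (getL CWS_S2 (getL PARENT_S2 c 0) []) 2 0 +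
                Vq c i 3 * getL (getL CWS_S2 (getL PARENT_S2 c 0) []) 3 0 + Vq c i 4 * getL (getL CWS_S2 (getL PARENT_S2 c 0) []) 4 0) (min (Vq c i 0 * 1 + Vq c i 2 * 2) (Vq c i 1 * 3)) = 0)))) = true := by
  decide +kernel

/-- ★ **The tag-4 side letters, unpacked** (with `C = V_c·m_L`, `A = V_c·(1,0,2,0,0)`, `B = V_c·(0,3,0,0,0)` as `mulVec`s). [certificate] -/
theorem tag4_side (c : Fin 1223) (zi : Fin 31) (ht : getL (getL TAGS_S2 c []) zi 9 = 4) :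
    (∃ i : Fin 5, (i : ℕ) ∈ getL ORB5 zi [] ∧
      min ((Vq c).mulVec (vecOf 5 [1, 0, 2, 0, 0]) i) ((Vq c).mulVec (vecOf 5 [0, 3, 0, 0, 0]) i) -
          min ((Vq c).mulVec (vecOf 5 (getL CWS_S2 (getL PARENT_S2 c 0) [])) i) (min ((Vq c).mulVec (vecOf 5 [1, 0, 2, 0, 0]) i) ((Vq c).mulVec (vecOf 5 [0, 3, 0, 0, 0]) i)) +
        ((Vq c).mulVec (vecOf 5 [1, 0, 2, 0, 0]) i - min ((Vq c).mulVec (vecOf 5 [1, 0, 2, 0, 0]) i) ((Vq c).mulVec (vecOf 5 [0, 3, 0, 0, 0]) i)) ≠ 0 ∧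
      (Vq c).mulVec (vecOf 5 (getL CWS_S2 (getL PARENT_S2 c 0) [])) i -
        min ((Vq c).mulVec (vecOf 5 (getL CWS_S2 (getL PARENT_S2 c 0) [])) i) (min ((Vq c).mulVec (vecOf 5 [1, 0, 2, 0, 0]) i) ((Vq c).mulVec (vecOf 5 [0, 3, 0, 0, 0]) i)) = 0) ∧
    (∃ i : Fin 5, (i : ℕ) ∈ getL ORB5 zi [] ∧
      min ((Vq c).mulVec (vecOf 5 [1, 0, 2, 0, 0]) i) ((Vq c).mulVec (vecOf 5 [0, 3, 0, 0, 0]) i) -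
          min ((Vq c).mulVec (vecOf 5 (getL CWS_S2 (getL PARENT_S2 c 0) [])) i) (min ((Vq c).mulVec (vecOf 5 [1, 0, 2, 0, 0]) i) ((Vq c).mulVec (vecOf 5 [0, 3, 0, 0, 0]) i)) +
        ((Vq c).mulVec (vecOf 5 [0, 3, 0, 0, 0]) i - min ((Vq c).mulVec (vecOf 5 [1, 0, 2, 0, 0]) i) ((Vq c).mulVec (vecOf 5 [0, 3, 0, 0, 0]) i)) ≠ 0 ∧
      (Vq c).mulVec (vecOf 5 (getL CWS_S2 (getL PARENT_S2 c 0) [])) i -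
        min ((Vq c).mulVec (vecOf 5 (getL CWS_S2 (getL PARENT_S2 c 0) [])) i) (min ((Vq c).mulVec (vecOf 5 [1, 0, 2, 0, 0]) i) ((Vq c).mulVec (vecOf 5 [0, 3, 0, 0, 0]) i)) = 0) := by
  have h := tag4_sideB c
  obtain ⟨_, _, _, _, _, _, _, _, _, hTl, hT31, _, hO⟩ := ExitTagSemantics.shapes_S2
  have htlen : (getL TAGS_S2 c []).length = 31 := ExitTagSemantics.length_of_allLen hT31 _ (getL_mem _ _ _ (by rw [hTl]; exact c.2))
  have hmem : (getL (getL TAGS_S2 c []) zi 9, getL ORB5 zi []) ∈ (getL TAGS_S2 c []).zip ORB5 :=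
    mk_getL_mem_zip (getL TAGS_S2 c []) ORB5 9 [] zi (by rw [htlen]; exact zi.2) (by rw [hO]; exact zi.2)
  rw [List.all_eq_true] at h
  have h1 := h _ hmem
  rw [ht] at h1
  simp only [Bool.or_eq_true, Bool.not_eq_true', Bool.and_eq_true, List.any_eq_true, List.mem_finRange, true_and, decide_eq_true_eq] at h1
  have h1' := h1.resolve_left (by decide)
  have eC : ∀ i : Fin 5, (Vq c).mulVec (vecOf 5 (getL CWS_S2 (getL PARENT_S2 c 0) [])) i =
      Vq c i 0 * getL (getL CWS_S2 (getL PARENT_S2 c 0) []) 0 0 + Vq c i 1 * getL (getL CWS_S2 (getL PARENT_S2 c 0) []) 1 0 + Vq c i 2 * getL (getL CWS_S2 (getL PARENT_S2 c 0) []) 2 0 +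
        Vq c i 3 * getL (getL CWS_S2 (getL PARENT_S2 c 0) []) 3 0 + Vq c i 4 * getL (getL CWS_S2 (getL PARENT_S2 c 0) []) 4 0 := fun i => by
    simp only [Matrix.mulVec, dotProduct, Fin.sum_univ_five, vecOf]; rfl
  have eA : ∀ i : Fin 5, (Vq c).mulVec (vecOf 5 [1, 0, 2, 0, 0]) i = Vq c i 0 * 1 + Vq c i 2 * 2 := fun i => by
    simp only [Matrix.mulVec, dotProduct, Fin.sum_univ_five, vecOf]
    simp [getL]
  have eB : ∀ i : Fin 5, (Vq c).mulVec (vecOf 5 [0, 3, 0, 0, 0]) i = Vq c i 1 * 3 := fun i => by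
    simp only [Matrix.mulVec, dotProduct, Fin.sum_univ_five, vecOf]
    simp [getL]
  simp only [eC, eA, eB]
  obtain ⟨⟨i, hi, hP⟩, ⟨j, hj, hQ⟩⟩ := h1'
  exact ⟨⟨i, hi, hP⟩, ⟨j, hj, hQ⟩⟩


end Summit.ResolutionOfSingularities.ResolutionOfSingularities.Theorems.FInjectiveMacaulayfication.OmegaOneS2Tag4Side

end
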